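/-
Copyright: internal research formalization. Source text: G. Kempf, Instability in invariant theory,
Ann. of Math. 108 (1978), Thm. 2.2 (existence and uniqueness of the optimal direction); Mumford–
Fogarty–Kirwan, GIT (3rd ed.), App. 2B. The statement here is the convex-analytic core only.
-/
import Mathlib
import HarnessLib

/-!
# The maximiser of a superadditive positively homogeneous function on a convex cone ∩ unit sphere

G. Kempf, *Instability in invariant theory*, Ann. of Math. **108** (1978), Thm. 2.2, reduces the
existence and UNIQUENESS of the "worst" destabilising one-parameter subgroup to the following
fact of convex analysis (the Killing form making the cocharacter space Euclidean): on a closed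
convex cone `C` in a finite-dimensional real inner product space, a continuous function `M` that is
positively homogeneous (`M (t • x) = t · M x`, `t ≥ 0`) and superadditive (`M x + M y ≤ M (x + y)`)
— e.g. the minimum of finitely many linear forms, Kempf's numerical function `min_j ⟨a, m_j⟩` —
attains its supremum on `C ∩ {‖a‖ = 1}`, and if that supremum is POSITIVE the maximiser is UNIQUE
(two distinct unit maximisers `a ≠ b` would give `(a + b)/‖a + b‖ ∈ C` with a strictly larger value,
since `‖a + b‖ < 2` by strict convexity of the Euclidean norm and `M (a + b) ≥ 2 · max`).

## Contents (theorem-only; no definitions)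

* `exists_isMaxOn_cone_inter_sphere` — existence of a maximiser on `C ∩ sphere 0 1` (compactness).
* `norm_add_lt_two_of_ne` — `‖a + b‖ < 2` for distinct unit vectors (parallelogram law).
* `eq_of_isMaxOn_cone_inter_sphere_of_pos` — uniqueness of the maximiser when the maximum is `> 0`.
* `existsUnique_isMaxOn_cone_inter_sphere` — the packaged `∃!`.
* The instance `M a = s.inf' hs (fun j => ℓ j a)` (minimum of finitely many continuous linear
  forms): `continuous_finset_inf'_clm`, `finset_inf'_clm_smul`, `finset_inf'_clm_superadditive`,
  `existsUnique_isMaxOn_finset_inf'_clm`; and `isClosed_convex_cone_of_forall_nonneg` — sets cut out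
  by linear inequalities `0 ≤ φ i a` are closed convex cones (the admissible cocharacters).

Consumer: the tree's Kempf optimal-parabolic programme for `SL_σ` over any algebraically closed
field (`Literature/Computability/AlgebraicComplexity/Kempf*.lean`, cell `val-lit`), towards
Mulmuley–Sohoni 2001 Thms. 4.6/4.7 in arbitrary characteristic. Honest framing: elementary convex
analysis; nothing here bears on any open problem.

## References

* [Kempf1978] G. R. Kempf, *Instability in invariant theory*, Ann. of Math. (2) 108 (1978),
  299–316, Thm. 2.2.
* [MumfordFogartyKirwan1994] D. Mumford, J. Fogarty, F. Kirwan, *Geometric Invariant Theory*,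
  3rd ed., Springer (1994), Ch. 2 §2 and App. 2B.
-/

noncomputable section

namespace Literature.Analysis.Convex

open Set Metric

section Abstract

variable {E : Type*} [NormedAddCommGroup E] [InnerProductSpace ℝ E]

/-- **Existence** (Kempf 1978, Thm. 2.2, existence half): a continuous function attains its
maximum on `C ∩ {‖a‖ = 1}` for `C` closed in a finite-dimensional space, as soon as this set is
nonempty (it is compact). [cite: Kempf1978, Thm. 2.2] -/
theorem exists_isMaxOn_cone_inter_sphere [FiniteDimensional ℝ E] {C : Set E} (hC : IsClosed C)
    {M : E → ℝ} (hM : Continuous M) (hne : (C ∩ sphere (0 : E) 1).Nonempty) :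
    ∃ a ∈ C ∩ sphere (0 : E) 1, IsMaxOn M (C ∩ sphere (0 : E) 1) a :=
  ((isCompact_sphere (0 : E) 1).inter_left hC).exists_isMaxOn hne hM.continuousOn

/-- **Strict convexity of the Euclidean norm**: two DISTINCT unit vectors have `‖a + b‖ < 2`
(parallelogram law: `‖a + b‖² = 4 - ‖a - b‖²`). [cite: MumfordFogartyKirwan1994, App. 2B] -/
theorem norm_add_lt_two_of_ne {a b : E} (ha : ‖a‖ = 1) (hb : ‖b‖ = 1) (hab : a ≠ b) :
    ‖a + b‖ < 2 := by
  have hpar := parallelogram_law_with_norm ℝ a b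
  rw [ha, hb] at hpar
  have hsub : 0 < ‖a - b‖ := norm_pos_iff.mpr (sub_ne_zero.mpr hab)
  have hsq : ‖a + b‖ * ‖a + b‖ < 2 * 2 := by nlinarith
  have hnn : 0 ≤ ‖a + b‖ := norm_nonneg _
  nlinarith

/-- A positively homogeneous function vanishes at the origin. [cite: Kempf1978, Thm. 2.2] -/
theorem apply_zero_of_posHom {M : E → ℝ} (hMhom : ∀ (t : ℝ) (x : E), 0 ≤ t → M (t • x) = t * M x) :
    M 0 = 0 := by
  have := hMhom 0 0 le_rfl
  simpa using this

/-- **Uniqueness** (Kempf 1978, Thm. 2.2, uniqueness half): on a convex cone `C`, a positively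
homogeneous superadditive function `M` has AT MOST ONE maximiser on `C ∩ {‖a‖ = 1}` once the maximum
is positive — for two distinct unit maximisers `a ≠ b`, the unit vector along `a + b ∈ C` has value
`M (a + b) / ‖a + b‖ ≥ 2 · max / ‖a + b‖ > max`. [cite: Kempf1978, Thm. 2.2] -/
theorem eq_of_isMaxOn_cone_inter_sphere_of_pos {C : Set E} (hCconv : Convex ℝ C)
    (hCcone : ∀ (t : ℝ) (x : E), 0 ≤ t → x ∈ C → t • x ∈ C) {M : E → ℝ}
    (hMhom : ∀ (t : ℝ) (x : E), 0 ≤ t → M (t • x) = t * M x)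
    (hMsup : ∀ x y : E, M x + M y ≤ M (x + y)) {a b : E}
    (ha : a ∈ C ∩ sphere (0 : E) 1) (hb : b ∈ C ∩ sphere (0 : E) 1)
    (hmax_a : IsMaxOn M (C ∩ sphere (0 : E) 1) a) (hmax_b : IsMaxOn M (C ∩ sphere (0 : E) 1) b)
    (hpos : 0 < M a) : a = b := by
  by_contra hab
  have ha1 : ‖a‖ = 1 := by simpa using ha.2
  have hb1 : ‖b‖ = 1 := by simpa using hb.2
  have hMab : M a = M b := le_antisymm (hmax_b ha) (hmax_a hb)
  -- `a + b ∈ C`, of norm `< 2`, nonzero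
  have hsum_mem : a + b ∈ C := by
    have h := hCconv ha.1 hb.1 (by norm_num : (0 : ℝ) ≤ 1 / 2) (by norm_num : (0 : ℝ) ≤ 1 / 2)
      (by norm_num)
    have h2 := hCcone 2 _ (by norm_num) h
    have : (2 : ℝ) • ((1 / 2 : ℝ) • a + (1 / 2 : ℝ) • b) = a + b := by
      rw [smul_add, smul_smul, smul_smul]; norm_num
    rwa [this] at h2
  have hlt : ‖a + b‖ < 2 := norm_add_lt_two_of_ne ha1 hb1 hab
  have hval : 2 * M a ≤ M (a + b) := by
    have := hMsup a b
    rw [← hMab] at this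
    linarith
  have hne : a + b ≠ 0 := by
    intro h0
    rw [h0, apply_zero_of_posHom hMhom] at hval
    linarith
  have hnpos : 0 < ‖a + b‖ := norm_pos_iff.mpr hne
  -- the rescaled vector beats the maximum
  set d : E := ‖a + b‖⁻¹ • (a + b) with hd
  have hdC : d ∈ C := hCcone _ _ (inv_nonneg.mpr hnpos.le) hsum_mem
  have hd1 : ‖d‖ = 1 := by
    rw [hd, norm_smul, norm_inv, norm_norm, inv_mul_cancel₀ hnpos.ne']
  have hdS : d ∈ C ∩ sphere (0 : E) 1 := ⟨hdC, by simpa using hd1⟩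
  have hMd : M d = ‖a + b‖⁻¹ * M (a + b) := by
    rw [hd, hMhom _ _ (inv_nonneg.mpr hnpos.le)]
  have hle : M d ≤ M a := hmax_a hdS
  rw [hMd] at hle
  -- `‖a+b‖⁻¹ · M(a+b) ≥ 2 M a / ‖a+b‖ > M a`
  have h1 : ‖a + b‖⁻¹ * M (a + b) ≥ ‖a + b‖⁻¹ * (2 * M a) :=
    mul_le_mul_of_nonneg_left hval (inv_nonneg.mpr hnpos.le)
  have h2 : ‖a + b‖⁻¹ * (2 * M a) > M a := by
    rw [gt_iff_lt, ← div_eq_inv_mul, lt_div_iff₀ hnpos]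
    nlinarith
  linarith

/-- **Kempf's Thm. 2.2, convex core** (existence and uniqueness): for a closed convex cone `C` in a
finite-dimensional real inner product space and a continuous, positively homogeneous, superadditive
`M : E → ℝ` taking a positive value at some unit vector of `C`, there is a UNIQUE maximiser of `M` on
`C ∩ {‖a‖ = 1}`. [cite: Kempf1978, Thm. 2.2] -/
theorem existsUnique_isMaxOn_cone_inter_sphere [FiniteDimensional ℝ E] {C : Set E}
    (hCconv : Convex ℝ C) (hCcone : ∀ (t : ℝ) (x : E), 0 ≤ t → x ∈ C → t • x ∈ C)
    (hCclosed : IsClosed C) {M : E → ℝ} (hMcont : Continuous M)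
    (hMhom : ∀ (t : ℝ) (x : E), 0 ≤ t → M (t • x) = t * M x)
    (hMsup : ∀ x y : E, M x + M y ≤ M (x + y))
    (hpos : ∃ x ∈ C, ‖x‖ = 1 ∧ 0 < M x) :
    ∃! a : E, a ∈ C ∩ sphere (0 : E) 1 ∧ IsMaxOn M (C ∩ sphere (0 : E) 1) a := by
  obtain ⟨x, hxC, hx1, hxpos⟩ := hpos
  have hxS : x ∈ C ∩ sphere (0 : E) 1 := ⟨hxC, by simpa using hx1⟩
  obtain ⟨a, haS, hmax⟩ := exists_isMaxOn_cone_inter_sphere hCclosed hMcont ⟨x, hxS⟩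
  have hapos : 0 < M a := hxpos.trans_le (hmax hxS)
  refine ⟨a, ⟨haS, hmax⟩, fun b hb => ?_⟩
  exact (eq_of_isMaxOn_cone_inter_sphere_of_pos hCconv hCcone hMhom hMsup haS hb.1 hmax hb.2
    hapos).symm

/-- The maximum value on `C ∩ {‖a‖ = 1}` bounds `M` on the whole cone after scaling:
`M x ≤ M a · ‖x‖` for `x ∈ C` (positive homogeneity). [cite: Kempf1978, Thm. 2.2] -/
theorem le_mul_norm_of_isMaxOn_cone_inter_sphere {C : Set E}
    (hCcone : ∀ (t : ℝ) (x : E), 0 ≤ t → x ∈ C → t • x ∈ C) {M : E → ℝ}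
    (hMhom : ∀ (t : ℝ) (x : E), 0 ≤ t → M (t • x) = t * M x) {a : E}
    (hmax : IsMaxOn M (C ∩ sphere (0 : E) 1) a) {x : E} (hx : x ∈ C) :
    M x ≤ M a * ‖x‖ := by
  by_cases hx0 : x = 0
  · subst hx0
    rw [apply_zero_of_posHom hMhom, norm_zero, mul_zero]
  have hnpos : 0 < ‖x‖ := norm_pos_iff.mpr hx0
  have hdS : ‖x‖⁻¹ • x ∈ C ∩ sphere (0 : E) 1 := by
    refine ⟨hCcone _ _ (inv_nonneg.mpr hnpos.le) hx, ?_⟩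
    rw [mem_sphere_zero_iff_norm, norm_smul, norm_inv, norm_norm, inv_mul_cancel₀ hnpos.ne']
  have hle : M (‖x‖⁻¹ • x) ≤ M a := hmax hdS
  rw [hMhom _ _ (inv_nonneg.mpr hnpos.le)] at hle
  rwa [inv_mul_le_iff₀ hnpos, mul_comm] at hle

end Abstract

/-! ### The instance: minimum of finitely many continuous linear forms -/

section MinLinear

variable {E : Type*} [NormedAddCommGroup E] [InnerProductSpace ℝ E] {ι : Type*}

/-- `a ↦ min_{j ∈ s} ℓ j a` is continuous. [cite: Kempf1978, Thm. 2.2] -/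
theorem continuous_finset_inf'_clm (s : Finset ι) (hs : s.Nonempty) (ℓ : ι → E →L[ℝ] ℝ) :
    Continuous fun a : E => s.inf' hs fun j => ℓ j a := by
  induction hs using Finset.Nonempty.cons_induction with
  | singleton i => simpa using (ℓ i).continuous
  | cons i t hit ht ih =>
    simp_rw [Finset.inf'_cons ht]
    exact (ℓ i).continuous.min ih

/-- `min_{j} ℓ j (t • a) = t · min_j ℓ j a` for `t ≥ 0` (positive homogeneity).
[cite: Kempf1978, Thm. 2.2] -/
theorem finset_inf'_clm_smul (s : Finset ι) (hs : s.Nonempty) (ℓ : ι → E →L[ℝ] ℝ) (t : ℝ)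
    (a : E) (ht : 0 ≤ t) :
    (s.inf' hs fun j => ℓ j (t • a)) = t * s.inf' hs fun j => ℓ j a := by
  have hmono : Monotone fun x : ℝ => t * x := fun x y hxy => mul_le_mul_of_nonneg_left hxy ht
  induction hs using Finset.Nonempty.cons_induction with
  | singleton i => simp [map_smul, smul_eq_mul]
  | cons i u hiu hu ih =>
    rw [Finset.inf'_cons hu, Finset.inf'_cons hu, ih, map_smul, smul_eq_mul]
    exact hmono.map_min.symm

/-- `min_j ℓ j a + min_j ℓ j b ≤ min_j ℓ j (a + b)` (superadditivity of a minimum of linear forms).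
[cite: Kempf1978, Thm. 2.2] -/
theorem finset_inf'_clm_superadditive (s : Finset ι) (hs : s.Nonempty) (ℓ : ι → E →L[ℝ] ℝ)
    (a b : E) :
    (s.inf' hs fun j => ℓ j a) + (s.inf' hs fun j => ℓ j b) ≤ s.inf' hs fun j => ℓ j (a + b) := by
  refine Finset.le_inf' hs _ fun j hj => ?_
  rw [map_add]
  exact add_le_add (Finset.inf'_le _ hj) (Finset.inf'_le _ hj)

/-- **Kempf's Thm. 2.2 for the numerical function `min_j ℓ j`**: on a closed convex cone `C` in a
finite-dimensional real inner product space, if `min_{j ∈ s} ℓ j x > 0` for some unit vector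
`x ∈ C`, then `a ↦ min_{j ∈ s} ℓ j a` has a UNIQUE maximiser on `C ∩ {‖a‖ = 1}`.
[cite: Kempf1978, Thm. 2.2] -/
theorem existsUnique_isMaxOn_finset_inf'_clm [FiniteDimensional ℝ E] (s : Finset ι) (hs : s.Nonempty)
    (ℓ : ι → E →L[ℝ] ℝ) {C : Set E}
    (hCconv : Convex ℝ C) (hCcone : ∀ (t : ℝ) (x : E), 0 ≤ t → x ∈ C → t • x ∈ C)
    (hCclosed : IsClosed C) (hpos : ∃ x ∈ C, ‖x‖ = 1 ∧ 0 < s.inf' hs fun j => ℓ j x) :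
    ∃! a : E, a ∈ C ∩ sphere (0 : E) 1 ∧
      IsMaxOn (fun a : E => s.inf' hs fun j => ℓ j a) (C ∩ sphere (0 : E) 1) a :=
  existsUnique_isMaxOn_cone_inter_sphere hCconv hCcone hCclosed (continuous_finset_inf'_clm s hs ℓ)
    (fun t a ht => finset_inf'_clm_smul s hs ℓ t a ht)
    (fun a b => finset_inf'_clm_superadditive s hs ℓ a b) hpos

end MinLinear

/-! ### Admissible directions: sets cut out by linear inequalities are closed convex cones -/

section Cones

variable {E : Type*} [NormedAddCommGroup E] [InnerProductSpace ℝ E]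

/-- The set `{a | ∀ i, 0 ≤ φ i a}` cut out by (any family of) continuous linear inequalities is a
CLOSED CONVEX CONE; linear equalities `ψ a = 0` are the pair of inequalities `0 ≤ ψ a`,
`0 ≤ -ψ a`. (Kempf's admissible cocharacters for a given state.) [cite: Kempf1978, §2] -/
theorem isClosed_convex_cone_of_forall_nonneg {κ : Type*} (φ : κ → E →L[ℝ] ℝ) :
    IsClosed {a : E | ∀ i, 0 ≤ φ i a} ∧ Convex ℝ {a : E | ∀ i, 0 ≤ φ i a} ∧
      ∀ (t : ℝ) (x : E), 0 ≤ t → x ∈ {a : E | ∀ i, 0 ≤ φ i a} → t • x ∈ {a : E | ∀ i, 0 ≤ φ i a} := by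
  refine ⟨?_, ?_, ?_⟩
  · have : {a : E | ∀ i, 0 ≤ φ i a} = ⋂ i, (fun a => φ i a) ⁻¹' Ici 0 := by
      ext a; simp
    rw [this]
    exact isClosed_iInter fun i => isClosed_Ici.preimage (φ i).continuous
  · intro x hx y hy u v hu hv _ i
    have hx' := hx i
    have hy' := hy i
    simp only [map_add, map_smul, smul_eq_mul]
    positivity
  · intro t x ht hx i
    simp only [map_smul, smul_eq_mul]
    exact mul_nonneg ht (hx i)

end Cones

end Literature.Analysis.Convex

end
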